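import Summits.Parity.GeneralizedHardyLittlewood.Theorems.BeyondDiagonalBeatsQuarter.KernelFormXSqCore
import Mathlib.MeasureTheory.Integral.IntervalIntegral.FundThmCalculus
import Mathlib.Analysis.SpecialFunctions.Log.Deriv
import Mathlib.Analysis.SpecialFunctions.Log.PosLog
import HarnessLib

/-!
# Route `PrimeLevelFamEdge`, crux K_A `MomentsBeyondDiagonal` (stmt-Parity-20007), line «petersson_layers» v4, stub `stub_diag`:
# **the integral recursion of logarithmic Riesz means** `R⁽ᶜ⁺¹⁾(z) = (c+1)∫₁^z R⁽ᶜ⁾(w) dw/w`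

Census item R3(i) of the `stub_diag` roadmap (`Cruxes/MomentsBeyondDiagonal/Lines/petersson_layers_stub_diag_roadmap.md`):
at `Q = 1` the explicit line series of `diagPart` IS K_B's kernel form `Σ_{a,b≤M} x_a x_b K_true(q̂;a,b)`
for a general admissible profile `P = Σ_{c ≥ 2} p_c X^c` (`…DiagSeriesAtOne`), and the K_B chain
(`Theorems/BeyondDiagonalBeatsQuarter/KernelFormXSq*`) evaluates it at `P = X²` through the Selberg
coordinates `A_n = W(n)·S(M/n;n)/log²M`, `S(y;n) = Σ_m h_n(m)·R⁽²⁾(y/m)`, `R⁽²⁾ = 2 + O(log⁻²)`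
(`KernelFormXSqRiesz`, `KernelFormXSqCore`). For the profile `X^c` the same rearrangement produces the
ORDER-`c` logarithmic Riesz mean of `(μ∗μ)/id`, `R⁽ᶜ⁾(z) = Σ_{k ≤ z} (G∗G)(k)·logᶜ(z/k)` (`G = μ/id`).
This file is the real-variable engine that raises the order (companion `…DiagRiesz`: every order `c ≥ 3`):

* `flatRiesz_succ_eq_integral` + `sum_posLog_pow_eq` — **`R⁽ᶜ⁺¹⁾(z) = ∫₁^z (c+1)R⁽ᶜ⁾(w) dw/w`** for ANY
  coefficient sequence (`logᶜ⁺¹(z/k) = (c+1)∫_k^z logᶜ(w/k)dw/w`, the integrand continued by `log⁺` below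
  `k`, finite sum and integral exchanged);
* `integral_log_pow_div`, `integral_one_add_log_pow_div`, `integral_inv_mul_one_add_log_sq` — the three
  explicit integrals `∫₁^z logʲw dw/w`, `∫₁^z (1+log w)ʲ dw/w`, `∫₁^z dw/(w(1+log w)²) = 1 − 1/(1+log z)`;
* `abs_flatRiesz_two_sub_two_le` — the tree's `R⁽²⁾ = 2 + O((1+log z)⁻²)` (`KernelFormXSqRiesz`) in the
  flat `(G∗G)` form, and `sum_G_mul_G_log_pow_eq_nested` — flat `=` nested `Σ_d μ(d)d⁻¹R_c(z/d)` at every order.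

Def-free; theorems only. Helper `--supports stmt-Parity-20007`; closes nothing; K_A, K_B and the Parity
summit are NOT proved; nothing about Landau–Siegel zeros.

## References
* H. L. Montgomery, R. C. Vaughan, *Multiplicative Number Theory I*, CUP 2007, §5.1 (Riesz typical means)
  and §8.1 (8.6)–(8.8). [cite: MontgomeryVaughan2007, §5.1 — derivation]
* E. Kowalski, P. Michel, J. VanderKam, J. reine angew. Math. 526 (2000), Prop. 5.1 p. 18.
  [cite: KowalskiMichelVanderKam2000, Prop. 5.1 — derivation]
-/

noncomputable section

open scoped Real ArithmeticFunction.Moebius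
open Finset ArithmeticFunction MeasureTheory intervalIntegral

namespace Summit.Parity.GeneralizedHardyLittlewood.Theorems.MomentsBeyondDiagonal.DiagKernel

open Literature.NumberTheory.LFunctions Literature.NumberTheory.LFunctions.KMV2000
open MollifierMainTerm (G moebiusRiesz)
open Summit.Parity.GeneralizedHardyLittlewood.Theorems.BeyondDiagonalBeatsQuarter.KernelFormXSq
  (sum_G_mul_G_eq_moebiusSqRiesz abs_moebiusSqRiesz_sub_two_le G_apply')

/-! ### Calculus lemmas: `logᶜ⁺¹(z/k) = (c+1)∫_k^z logᶜ(w/k) dw/w` and three explicit integrals -/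

/-- `logᶜ⁺¹(z/k) = (c+1)·∫_k^z logᶜ(w/k) dw/w` for `0 < k ≤ z` (fundamental theorem of calculus). [folklore] -/
theorem log_pow_succ_eq_integral {k z : ℝ} (hk : 0 < k) (hkz : k ≤ z) (c : ℕ) :
    Real.log (z / k) ^ (c + 1) = ∫ w in k..z, (c + 1 : ℝ) * Real.log (w / k) ^ c / w := by
  have hne : ∀ w ∈ Set.uIcc k z, w ≠ 0 := by
    intro w hw
    rw [Set.uIcc_of_le hkz] at hw
    exact (hk.trans_le hw.1).ne'
  have hderiv : ∀ w ∈ Set.uIcc k z, HasDerivAt (fun w : ℝ ↦ Real.log (w / k) ^ (c + 1))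
      ((c + 1 : ℝ) * Real.log (w / k) ^ c / w) w := by
    intro w hw
    have hw0 : w ≠ 0 := hne w hw
    have h1 : HasDerivAt (fun w : ℝ ↦ w / k) (1 / k) w := by
      simpa using (hasDerivAt_id w).div_const k
    have h2 : HasDerivAt (fun w : ℝ ↦ Real.log (w / k)) ((1 / k) / (w / k)) w :=
      h1.log (div_ne_zero hw0 hk.ne')
    refine (h2.fun_pow (c + 1)).congr_deriv ?_
    rw [Nat.add_sub_cancel]
    push_cast
    field_simp
  have hcont : ContinuousOn (fun w : ℝ ↦ (c + 1 : ℝ) * Real.log (w / k) ^ c / w) (Set.uIcc k z) := by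
    have hl : ContinuousOn (fun w : ℝ ↦ Real.log (w / k)) (Set.uIcc k z) :=
      (continuousOn_id.div_const k).log fun w hw ↦ div_ne_zero (hne w hw) hk.ne'
    exact (continuousOn_const.mul (hl.pow c)).div continuousOn_id hne
  rw [integral_eq_sub_of_hasDerivAt hderiv hcont.intervalIntegrable]
  simp [div_self hk.ne']

/-- `∫₁^z logʲ w dw/w = log^{j+1} z/(j+1)` for `z ≥ 1`. [folklore] -/
theorem integral_log_pow_div {z : ℝ} (hz : 1 ≤ z) (j : ℕ) :
    ∫ w in (1 : ℝ)..z, Real.log w ^ j / w = Real.log z ^ (j + 1) / (j + 1) := by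
  have hne : ∀ w ∈ Set.uIcc 1 z, w ≠ 0 := by
    intro w hw
    rw [Set.uIcc_of_le hz] at hw
    exact (zero_lt_one.trans_le hw.1).ne'
  have hderiv : ∀ w ∈ Set.uIcc 1 z, HasDerivAt (fun w : ℝ ↦ Real.log w ^ (j + 1) / (j + 1))
      (Real.log w ^ j / w) w := by
    intro w hw
    have hw0 : w ≠ 0 := hne w hw
    refine (((Real.hasDerivAt_log hw0).fun_pow (j + 1)).div_const (j + 1 : ℝ)).congr_deriv ?_
    rw [Nat.add_sub_cancel]
    push_cast
    field_simp
  have hcont : ContinuousOn (fun w : ℝ ↦ Real.log w ^ j / w) (Set.uIcc 1 z) :=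
    ((continuousOn_id.log hne).pow j).div continuousOn_id hne
  rw [integral_eq_sub_of_hasDerivAt hderiv hcont.intervalIntegrable]
  simp

/-- `∫₁^z (1 + log w)ʲ dw/w = ((1 + log z)^{j+1} − 1)/(j+1)` for `z ≥ 1`. [folklore] -/
theorem integral_one_add_log_pow_div {z : ℝ} (hz : 1 ≤ z) (j : ℕ) :
    ∫ w in (1 : ℝ)..z, (1 + Real.log w) ^ j / w =
      ((1 + Real.log z) ^ (j + 1) - 1) / (j + 1) := by
  have hne : ∀ w ∈ Set.uIcc 1 z, w ≠ 0 := by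
    intro w hw
    rw [Set.uIcc_of_le hz] at hw
    exact (zero_lt_one.trans_le hw.1).ne'
  have hderiv : ∀ w ∈ Set.uIcc 1 z, HasDerivAt (fun w : ℝ ↦ (1 + Real.log w) ^ (j + 1) / (j + 1))
      ((1 + Real.log w) ^ j / w) w := by
    intro w hw
    have hw0 : w ≠ 0 := hne w hw
    have h1 : HasDerivAt (fun w : ℝ ↦ 1 + Real.log w) w⁻¹ w := (Real.hasDerivAt_log hw0).const_add 1
    refine ((h1.fun_pow (j + 1)).div_const (j + 1 : ℝ)).congr_deriv ?_
    rw [Nat.add_sub_cancel]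
    push_cast
    field_simp
  have hcont : ContinuousOn (fun w : ℝ ↦ (1 + Real.log w) ^ j / w) (Set.uIcc 1 z) :=
    ((continuousOn_const.add (continuousOn_id.log hne)).pow j).div continuousOn_id hne
  rw [integral_eq_sub_of_hasDerivAt hderiv hcont.intervalIntegrable]
  simp
  ring

/-- `∫₁^z dw/(w(1 + log w)²) = 1 − 1/(1 + log z)` for `z ≥ 1`. [folklore] -/
theorem integral_inv_mul_one_add_log_sq {z : ℝ} (hz : 1 ≤ z) :
    ∫ w in (1 : ℝ)..z, 1 / ((1 + Real.log w) ^ 2 * w) = 1 - 1 / (1 + Real.log z) := by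
  have hpos : ∀ w ∈ Set.uIcc 1 z, 0 < w := by
    intro w hw
    rw [Set.uIcc_of_le hz] at hw
    exact zero_lt_one.trans_le hw.1
  have hne : ∀ w ∈ Set.uIcc 1 z, w ≠ 0 := fun w hw ↦ (hpos w hw).ne'
  have hlog : ∀ w ∈ Set.uIcc 1 z, 1 + Real.log w ≠ 0 := by
    intro w hw
    rw [Set.uIcc_of_le hz] at hw
    have := Real.log_nonneg hw.1
    positivity
  have hderiv : ∀ w ∈ Set.uIcc 1 z, HasDerivAt (fun w : ℝ ↦ -(1 + Real.log w)⁻¹)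
      (1 / ((1 + Real.log w) ^ 2 * w)) w := by
    intro w hw
    have hw0 : w ≠ 0 := hne w hw
    have hl := hlog w hw
    have h1 : HasDerivAt (fun w : ℝ ↦ 1 + Real.log w) w⁻¹ w := (Real.hasDerivAt_log hw0).const_add 1
    refine ((h1.fun_inv hl).fun_neg).congr_deriv ?_
    field_simp
  have hcont : ContinuousOn (fun w : ℝ ↦ 1 / ((1 + Real.log w) ^ 2 * w)) (Set.uIcc 1 z) := by
    refine continuousOn_const.div ?_ fun w hw ↦ mul_ne_zero (pow_ne_zero 2 (hlog w hw)) (hne w hw)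
    exact ((continuousOn_const.add (continuousOn_id.log hne)).pow 2).mul continuousOn_id
  rw [integral_eq_sub_of_hasDerivAt hderiv hcont.intervalIntegrable]
  simp
  ring

/-! ### The continued integrand `log⁺(w/k)ᶜ/w` -/

/-- `w ↦ C·(log⁺(w/k))ᶜ/w` is continuous on any set of non-zero reals. [folklore] -/
theorem continuousOn_const_mul_posLog_pow_div (C k : ℝ) (c : ℕ) {s : Set ℝ} (hs : ∀ w ∈ s, w ≠ 0) :
    ContinuousOn (fun w : ℝ ↦ C * Real.posLog (w / k) ^ c / w) s := by
  have h1 : ContinuousOn (fun w : ℝ ↦ Real.posLog (w / k)) s :=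
    (Real.continuous_posLog.comp (continuous_id.div_const k)).continuousOn
  exact (continuousOn_const.mul (h1.pow c)).div continuousOn_id hs

/-- For `0 < k ≤ w`: `log⁺(w/k) = log(w/k)`. [folklore] -/
theorem posLog_div_eq_log {k w : ℝ} (hk : 0 < k) (hkw : k ≤ w) :
    Real.posLog (w / k) = Real.log (w / k) := by
  refine Real.posLog_eq_log ?_
  rw [abs_of_nonneg (div_nonneg (hk.le.trans hkw) hk.le)]
  exact (one_le_div hk).2 hkw

/-- For `0 < w ≤ k`: `log⁺(w/k) = 0`. [folklore] -/
theorem posLog_div_eq_zero {k w : ℝ} (hw : 0 < w) (hwk : w ≤ k) :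
    Real.posLog (w / k) = 0 := by
  refine (Real.posLog_eq_zero_iff _).2 ?_
  have hk : 0 < k := hw.trans_le hwk
  rw [abs_of_nonneg (div_nonneg hw.le hk.le)]
  exact (div_le_one hk).2 hwk

/-- For `1 ≤ k ≤ z` and `c ≥ 1`: `(c+1)∫_k^z logᶜ(w/k)dw/w = (c+1)∫₁^z log⁺(w/k)ᶜ dw/w` — the continued
integrand vanishes on `[1,k]`. [folklore] -/
theorem integral_log_pow_eq_integral_posLog {k z : ℝ} (hk : 1 ≤ k) (hkz : k ≤ z) {c : ℕ} (hc : 1 ≤ c) :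
    ∫ w in k..z, (c + 1 : ℝ) * Real.log (w / k) ^ c / w =
      ∫ w in (1 : ℝ)..z, (c + 1 : ℝ) * Real.posLog (w / k) ^ c / w := by
  have hk0 : 0 < k := zero_lt_one.trans_le hk
  have hcont : ∀ a b : ℝ, 0 < a → a ≤ b →
      IntervalIntegrable (fun w : ℝ ↦ (c + 1 : ℝ) * Real.posLog (w / k) ^ c / w) volume a b := by
    intro a b ha hab
    refine ContinuousOn.intervalIntegrable ?_
    have hs : ∀ w ∈ Set.uIcc a b, w ≠ 0 := by
      intro w hw
      rw [Set.uIcc_of_le hab] at hw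
      exact (ha.trans_le hw.1).ne'
    exact continuousOn_const_mul_posLog_pow_div _ k c hs
  rw [← integral_add_adjacent_intervals (hcont 1 k zero_lt_one hk) (hcont k z hk0 hkz)]
  have h0 : ∫ w in (1 : ℝ)..k, (c + 1 : ℝ) * Real.posLog (w / k) ^ c / w = 0 := by
    rw [← intervalIntegral.integral_zero (a := (1 : ℝ)) (b := k)]
    refine integral_congr fun w hw ↦ ?_
    rw [Set.uIcc_of_le hk] at hw
    have hw0 : 0 < w := zero_lt_one.trans_le hw.1
    simp [posLog_div_eq_zero hw0 hw.2, zero_pow (by omega : c ≠ 0)]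
  rw [h0, zero_add]
  refine integral_congr fun w hw ↦ ?_
  rw [Set.uIcc_of_le hkz] at hw
  simp only [posLog_div_eq_log hk0 hw.1]

/-! ### The integral recursion `R⁽ᶜ⁺¹⁾(z) = (c+1)∫₁^z R⁽ᶜ⁾(w) dw/w` -/

/-- **Integral recursion for logarithmic Riesz means** (any coefficients `a`, `c ≥ 1`, `z ≥ 1`):
`Σ_{k ≤ z} a_k logᶜ⁺¹(z/k) = ∫₁^z Σ_{k ≤ z} a_k·(c+1)log⁺(w/k)ᶜ/w dw`; the integrand is `(c+1)R⁽ᶜ⁾(w)/w`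
(`sum_posLog_pow_eq`). [cite: MontgomeryVaughan2007, §5.1 — derivation (Riesz typical means)] -/
theorem flatRiesz_succ_eq_integral (a : ℕ → ℝ) {c : ℕ} (hc : 1 ≤ c) {z : ℝ} (hz : 1 ≤ z) :
    ∑ k ∈ Icc 1 ⌊z⌋₊, a k * Real.log (z / k) ^ (c + 1) =
      ∫ w in (1 : ℝ)..z, ∑ k ∈ Icc 1 ⌊z⌋₊, a k * ((c + 1 : ℝ) * Real.posLog (w / k) ^ c / w) := by
  have hz0 : 0 < z := zero_lt_one.trans_le hz
  have hint : ∀ k ∈ Icc 1 ⌊z⌋₊,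
      IntervalIntegrable (fun w : ℝ ↦ a k * ((c + 1 : ℝ) * Real.posLog (w / k) ^ c / w)) volume 1 z := by
    intro k hk
    refine ContinuousOn.intervalIntegrable (continuousOn_const.mul ?_)
    have hs : ∀ w ∈ Set.uIcc 1 z, w ≠ 0 := by
      intro w hw
      rw [Set.uIcc_of_le hz] at hw
      exact (zero_lt_one.trans_le hw.1).ne'
    exact continuousOn_const_mul_posLog_pow_div _ (k : ℝ) c hs
  rw [intervalIntegral.integral_finsetSum hint]
  refine Finset.sum_congr rfl fun k hk ↦ ?_
  have hk' := Finset.mem_Icc.1 hk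
  have hk1 : (1 : ℝ) ≤ k := by exact_mod_cast hk'.1
  have hk0 : (0 : ℝ) < k := by positivity
  have hkz : (k : ℝ) ≤ z := (Nat.le_floor_iff hz0.le).1 hk'.2
  rw [intervalIntegral.integral_const_mul, log_pow_succ_eq_integral hk0 hkz c,
    integral_log_pow_eq_integral_posLog hk1 hkz hc]

/-- The continued integrand IS the Riesz mean of one order less: for `1 ≤ w`, `⌊w⌋ ≤ N`, `c ≥ 1`,
`Σ_{k ≤ N} a_k (c+1) log⁺(w/k)ᶜ/w = ((c+1)/w)·Σ_{k ≤ w} a_k logᶜ(w/k)`. [folklore] -/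
theorem sum_posLog_pow_eq (a : ℕ → ℝ) {c : ℕ} (hc : 1 ≤ c) {w : ℝ} (hw : 1 ≤ w) {N : ℕ}
    (hN : ⌊w⌋₊ ≤ N) :
    ∑ k ∈ Icc 1 N, a k * ((c + 1 : ℝ) * Real.posLog (w / k) ^ c / w) =
      (c + 1 : ℝ) / w * ∑ k ∈ Icc 1 ⌊w⌋₊, a k * Real.log (w / k) ^ c := by
  have hw0 : 0 < w := zero_lt_one.trans_le hw
  have hsub : Icc 1 ⌊w⌋₊ ⊆ Icc 1 N := Finset.Icc_subset_Icc_right hN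
  rw [Finset.mul_sum, ← Finset.sum_subset hsub]
  · refine Finset.sum_congr rfl fun k hk ↦ ?_
    have hk' := Finset.mem_Icc.1 hk
    have hk0 : (0 : ℝ) < k := by exact_mod_cast hk'.1
    have hkw : (k : ℝ) ≤ w := (Nat.le_floor_iff hw0.le).1 hk'.2
    rw [posLog_div_eq_log hk0 hkw]
    ring
  · intro k hkN hkw
    have hk1 : 1 ≤ k := (Finset.mem_Icc.1 hkN).1
    have hlt : ⌊w⌋₊ < k := by
      by_contra h
      exact hkw (Finset.mem_Icc.2 ⟨hk1, not_lt.1 h⟩)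
    have hwk : w < k := Nat.lt_of_floor_lt hlt
    rw [posLog_div_eq_zero hw0 hwk.le, zero_pow (by omega : c ≠ 0)]
    simp

/-! ### The order-two input and the nested form -/

/-- The tree's `R⁽²⁾(z) = 2 + O((1 + log z)⁻²)` in the flat `(G∗G)` form:
`|Σ_{k ≤ z} (G∗G)(k) log²(z/k) − 2| ≤ C/(1 + log z)²` (`G = μ/id`).
[cite: MontgomeryVaughan2007, §8.1 (8.6)–(8.8) — derivation] -/
theorem abs_flatRiesz_two_sub_two_le :
    ∃ C : ℝ, 0 < C ∧ ∀ z : ℝ, 1 ≤ z →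
      |∑ k ∈ Icc 1 ⌊z⌋₊, (G * G) k * Real.log (z / k) ^ 2 - 2| ≤ C / (1 + Real.log z) ^ 2 := by
  obtain ⟨C, hC, h⟩ := abs_moebiusSqRiesz_sub_two_le
  exact ⟨C, hC, fun z hz ↦ by rw [sum_G_mul_G_eq_moebiusSqRiesz]; exact h z hz⟩

/-- The nested form: `Σ_{k ≤ z} (G∗G)(k)·logᶜ(z/k) = Σ_{d ≤ z} μ(d)d⁻¹·R_c(z/d)` with `R_c = moebiusRiesz c`
(Dirichlet's rearrangement of the convolution). [folklore] -/
theorem sum_G_mul_G_log_pow_eq_nested (c : ℕ) (z : ℝ) :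
    ∑ k ∈ Icc 1 ⌊z⌋₊, (G * G) k * Real.log (z / k) ^ c =
      ∑ d ∈ Icc 1 ⌊z⌋₊, (μ d : ℝ) / d * moebiusRiesz c (z / d) := by
  classical
  rw [Literature.Barriers.Parity.Icc_one_eq_Ioc_zero]
  have h1 : ∑ j ∈ Ioc 0 ⌊z⌋₊, (G * G) j * Real.log (z / j) ^ c =
      ∑ j ∈ Ioc 0 ⌊z⌋₊, ∑ x ∈ j.divisorsAntidiagonal,
        G x.1 * G x.2 * Real.log (z / ((x.1 * x.2 : ℕ) : ℝ)) ^ c := by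
    refine Finset.sum_congr rfl fun j _ ↦ ?_
    rw [mul_apply, Finset.sum_mul]
    refine Finset.sum_congr rfl fun x hx ↦ ?_
    rw [(Nat.mem_divisorsAntidiagonal.1 hx).1]
  rw [h1, SiegelWalfiszLiouville.sum_Ioc_sum_divisorsAntidiagonal_eq
    (fun a b ↦ G a * G b * Real.log (z / ((a * b : ℕ) : ℝ)) ^ c) ⌊z⌋₊]
  refine Finset.sum_congr rfl fun d hd ↦ ?_
  have hd0 : (0 : ℝ) < d := by exact_mod_cast (Finset.mem_Ioc.1 hd).1
  unfold moebiusRiesz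
  rw [Nat.floor_div_natCast, Literature.Barriers.Parity.Icc_one_eq_Ioc_zero, Finset.mul_sum]
  refine Finset.sum_congr rfl fun e _ ↦ ?_
  rw [G_apply', G_apply']
  push_cast
  rw [div_div]
  ring

end Summit.Parity.GeneralizedHardyLittlewood.Theorems.MomentsBeyondDiagonal.DiagKernel

end
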